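import Summits.ABC.ABC.Theorems.PadicPrimesYuNinetyThreeModFourTransfer
import HarnessLib

set_option linter.dupNamespace false

/-!
# Route PadicPrimesYuNinety: the transfers from the FLOORED engine (`Real.log p ≤ W` added) to the
# odd residue-class cruxes `YuNinetyThreeModFour` (stmt-ABC-19249) and `YuNinetyOneModFour` (stmt-ABC-19250)

`Summits/ABC/ABC/Theorems/PadicPrimesYuNinetyFlooredEngineTransfer.lean` — cell `abc-stewartyu`, seat p3
(g2), sequel to `PadicPrimesYuNinetyOddEngineTransfer.lean`.

The lead of crux 19249 (p2-g2, STATUS 2026-08-26T04:44:52Z (c); planner g4 05:09Z: no objection)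
re-registers the engine stub with ONE repair: Yu's `W*` carries the floor `max(W, log p)`
(Yu 1990 (2.13): `S = q[c₃(n+1)DW*/(f log p)] ≥ q`), which the conclusion
`C(m)·p·∏(Vⱼ/log p)·W·(log Vmax + log p)/(log p)²` cannot absorb when `W, Vmax ≪ log p`; so the
hypothesis `Real.log p ≤ W` is ADDED to the engine (here: right after the `W`-bound on the `bⱼ`). This
file re-runs the transfer for that floored engine: feed `W := log B · log p` (`≥ log p` and
`≥ log max(3,|bⱼ|)` since `log B ≥ log 3 > 1`), so the bound reads
`C(m)·p·(∏ log max(4,q))·log B·(log Vmax + log p)/log p`, and the garbage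
`(log Vmax + log p)/log p = 1 + (log log p + log X)/log p ≤ 2 + log X` (`X = log max(4, sup S)`,
`log log p ≤ log p − 1`) is paid by the crux's spare factor `p`: `p·(2 + log X) < 5p²·log X`
(`p ≥ 3`, `log X ≥ 0.27`). Constants as before: `c₅ = 5c₁`.

* `padicPrimesYuNinety_residueClass_of_flooredEngine` — generic in a residue predicate `P` with
  `¬ P 2` (as in the unfloored file);
* `padicPrimesYuNinety_threeModFour_of_flooredOddEngine` / `…_oneModFour_of_flooredOddEngine` — both
  cruxes BY NAME from the floored ODD engine (`P p := p ≠ 2`);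
* `padicPrimesYuNinety_threeModFour_of_flooredEngineThree` / `…_oneModFour_of_flooredEngineOne` —
  from floored engines stated at one residue class only (the re-registered `stub_engine` of 19249
  is the first of these up to the order of its binders: `stub_transfer := fun h => …_of_flooredEngineThree h`).

Everything is [folklore] bookkeeping. WHAT THIS IS NOT: no engine is proved here.
-/

noncomputable section

open Finset Real Height

namespace Summit.ABC.ABC.Theorems

/-- **Generic residue-class transfer, floored engine.** For a predicate `P` on primes with `¬ P 2`: an engine bound
`ord_p(∏ αⱼ^{bⱼ} − 1) ≤ C(m)·p·∏(Vⱼ/log p)·W·(log Vmax + log p)/(log p)²` (`C(m) ≤ c₁^m m^m`) for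
rational `p`-adic units (multiplicatively independent, no signed sub-product a square) at every prime
with `P p` gives, at every prime with `P p`, the crux text of route `PadicPrimesYuNinety` with
`c₅ = 5c₁`: `ord_p(∏_{q∈S} q^{e_q} − 1) < (c₅ #S)^{#S}·p²·log B·log log max(4, sup S)·∏ log max(4,q)`.
Here the engine carries the extra floor `Real.log p ≤ W`; it is fed `W := log B · log p` and the
lost `log p` is paid by the crux's spare factor `p`. [folklore] -/
theorem padicPrimesYuNinety_residueClass_of_flooredEngine (P : ℕ → Prop) (hP2 : ¬ P 2)
    (hE : ∃ (C : ℕ → ℝ) (c₁ : ℝ), 1 ≤ c₁ ∧ (∀ m, 0 ≤ C m ∧ C m ≤ c₁ ^ m * (m : ℝ) ^ m) ∧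
      ∀ (p : ℕ), p.Prime → P p → ∀ (m : ℕ) (α : Fin m → ℚ) (b : Fin m → ℤ) (V : Fin m → ℝ)
        (Vmax W : ℝ),
        (∀ j, α j ≠ 0 ∧ padicValRat p (α j) = 0) →
        (∀ μ : Fin m → ℤ, ∏ j, α j ^ μ j = 1 → μ = 0) →
        (∀ T : Finset (Fin m), T.Nonempty → ¬ IsSquare (∏ j ∈ T, α j) ∧ ¬ IsSquare (-∏ j ∈ T, α j)) →
        (∀ j, Height.logHeight₁ (α j) ≤ V j) → (∀ j, Real.log p ≤ V j) → (∀ j, V j ≤ Vmax) →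
        b ≠ 0 → (∀ j, Real.log (max 3 (|b j| : ℝ)) ≤ W) → Real.log p ≤ W →
        (padicValRat p (∏ j, α j ^ b j - 1) : ℝ) ≤
          C m * p * (∏ j, V j / Real.log p) * W * (Real.log Vmax + Real.log p) / Real.log p ^ 2) :
    ∃ c₅ : ℝ, ∀ (p : ℕ), p.Prime → P p → ∀ (S : Finset ℕ), (∀ q ∈ S, q.Prime) → p ∉ S →
      S.Nonempty → ∀ (e : ℕ → ℤ) (B : ℝ), 3 ≤ B → (∀ q ∈ S, (|e q| : ℝ) ≤ B) →
      ∏ q ∈ S, (q : ℚ) ^ e q ≠ 1 →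
      (padicValRat p (∏ q ∈ S, (q : ℚ) ^ e q - 1) : ℝ) <
        (c₅ * S.card) ^ S.card * (p : ℝ) ^ 2 * Real.log B *
          Real.log (Real.log ((max 4 (S.sup id) : ℕ) : ℝ)) * ∏ q ∈ S, Real.log ((max 4 q : ℕ) : ℝ) := by
  classical
  obtain ⟨C, c₁, hc₁, hC, hA⟩ := hE
  refine ⟨5 * c₁, ?_⟩
  intro p hp hPp S hS hpS hSne e B hB heB hne1
  have hp2 : p ≠ 2 := fun h => hP2 (h ▸ hPp)
  haveI := Fact.mk hp
  -- enumeration of `S`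
  set m : ℕ := S.card with hm
  have hm1 : 1 ≤ m := Finset.card_pos.mpr hSne
  set φ : Fin m ≃ S := S.equivFin.symm with hφ
  set q : Fin m → ℕ := fun i => (φ i : ℕ) with hqdef
  have hqS : ∀ i, q i ∈ S := fun i => (φ i).2
  have hqP : ∀ i, (q i).Prime := fun i => hS _ (hqS i)
  have hinj : Function.Injective q := fun i j hij => φ.injective (Subtype.ext hij)
  have hqp : ∀ i, q i ≠ p := fun i h => hpS (h ▸ hqS i)
  have hreidx : ∀ {M : Type} [CommMonoid M] (f : ℕ → M), ∏ i, f (q i) = ∏ x ∈ S, f x := by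
    intro M _ f
    rw [← Finset.prod_coe_sort S f]
    exact Fintype.prod_equiv φ (fun i => f (q i)) (fun x => f x) (fun i => rfl)
  -- the data fed to the engine
  set L : ℝ := Real.log p with hL
  set M4 : ℝ := ((max 4 (S.sup id) : ℕ) : ℝ) with hM4
  set X : ℝ := Real.log M4 with hX
  set α : Fin m → ℚ := fun j => (q j : ℚ) with hα
  set b : Fin m → ℤ := fun j => e (q j) with hb
  set V : Fin m → ℝ := fun j => L * Real.log ((max 4 (q j) : ℕ) : ℝ) with hV
  set Vmax : ℝ := L * X with hVmax
  set W : ℝ := Real.log B * L with hW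
  -- numerics of `p ≥ 3`
  have hp3 : 3 ≤ p := by have := hp.two_le; omega
  have hp3R : (3 : ℝ) ≤ p := by exact_mod_cast hp3
  have hpR0 : (0 : ℝ) < p := by linarith
  have hL1 : 1 < L := by
    have h3 : (1 : ℝ) < Real.log 3 := by
      rw [Real.lt_log_iff_exp_lt (by norm_num)]
      exact Real.exp_one_lt_d9.trans (by norm_num)
    exact h3.trans_le (Real.log_le_log (by norm_num) hp3R)
  have hL0 : 0 < L := by linarith
  have hX1 : (1.38 : ℝ) ≤ X := (loglog_max_four_bounds (S.sup id)).1
  have hℓ : (0.27 : ℝ) ≤ Real.log X := (loglog_max_four_bounds (S.sup id)).2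
  have hX0 : 0 < X := by linarith
  have hlogmax : ∀ j, (1.38 : ℝ) ≤ Real.log ((max 4 (q j) : ℕ) : ℝ) := fun j =>
    (loglog_max_four_bounds (q j)).1
  -- the engine's hypotheses
  have h1 : ∀ j, α j ≠ 0 ∧ padicValRat p (α j) = 0 := fun j =>
    ⟨by simp only [hα]; exact_mod_cast (hqP j).ne_zero,
      Literature.Barriers.ABC.StewartTijdemanGeneric.padicValRat_natCast_prime_of_ne hp (hqP j) (hqp j)⟩
  have h2 : ∀ μ : Fin m → ℤ, ∏ j, α j ^ μ j = 1 → μ = 0 := fun μ hμ =>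
    Literature.Barriers.ABC.StewartTijdemanGeneric.prime_family_zpow_eq_one hqP hinj hμ
  have h3 : ∀ T : Finset (Fin m), T.Nonempty →
      ¬ IsSquare (∏ j ∈ T, α j) ∧ ¬ IsSquare (-∏ j ∈ T, α j) := fun T hT =>
    not_isSquare_prod_distinct_primes q hqP hinj T hT
  have h4 : ∀ j, logHeight₁ (α j) ≤ V j := by
    intro j
    haveI : NeZero (q j) := ⟨(hqP j).ne_zero⟩
    have hh : logHeight₁ (α j) = Real.log (q j) := by
      simp only [hα]; exact Rat.logHeight₁_natCast (q j)
    rw [hh]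
    have hq4 : Real.log (q j) ≤ Real.log ((max 4 (q j) : ℕ) : ℝ) :=
      Real.log_le_log (by exact_mod_cast (hqP j).pos) (by exact_mod_cast le_max_right 4 (q j))
    calc Real.log (q j) ≤ Real.log ((max 4 (q j) : ℕ) : ℝ) := hq4
      _ ≤ L * Real.log ((max 4 (q j) : ℕ) : ℝ) :=
          le_mul_of_one_le_left (by linarith [hlogmax j]) hL1.le
  have h5 : ∀ j, Real.log p ≤ V j := fun j => by
    show L ≤ L * Real.log ((max 4 (q j) : ℕ) : ℝ)
    exact le_mul_of_one_le_right hL0.le (by linarith [hlogmax j])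
  have h6 : ∀ j, V j ≤ Vmax := by
    intro j
    have hle : ((max 4 (q j) : ℕ) : ℝ) ≤ M4 := by
      rw [hM4]
      exact_mod_cast max_le_max le_rfl (Finset.le_sup (f := id) (hqS j))
    have hpos : (0 : ℝ) < ((max 4 (q j) : ℕ) : ℝ) := by
      exact_mod_cast lt_of_lt_of_le (by norm_num) (le_max_left 4 (q j))
    exact mul_le_mul_of_nonneg_left (Real.log_le_log hpos hle) hL0.le
  have hprodQ : ∏ j, α j ^ b j = ∏ x ∈ S, (x : ℚ) ^ e x := hreidx (fun x => (x : ℚ) ^ e x)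
  have h7 : b ≠ 0 := by
    intro h0
    apply hne1
    rw [← hprodQ]
    exact Finset.prod_eq_one fun j _ => by rw [show b j = 0 from congrFun h0 j, zpow_zero]
  have hB0 : 0 < Real.log B := Real.log_pos (by linarith)
  have hB1 : 1 ≤ Real.log B := by
    have h3 : (1 : ℝ) < Real.log 3 := by
      rw [Real.lt_log_iff_exp_lt (by norm_num)]
      exact Real.exp_one_lt_d9.trans (by norm_num)
    exact h3.le.trans (Real.log_le_log (by norm_num) hB)
  have hWge : Real.log B ≤ W := by
    rw [hW]; exact le_mul_of_one_le_right hB0.le hL1.le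
  have h8 : ∀ j, Real.log (max 3 (|b j| : ℝ)) ≤ W := by
    intro j
    have hle : max 3 (|b j| : ℝ) ≤ B := max_le hB (by simp only [hb]; exact heB _ (hqS j))
    exact (Real.log_le_log (lt_of_lt_of_le (by norm_num) (le_max_left _ _)) hle).trans hWge
  have h9 : Real.log p ≤ W := by
    rw [hW, ← hL]; exact le_mul_of_one_le_left hL0.le hB1
  -- the engine
  have key := hA p hp hPp m α b V Vmax W h1 h2 h3 h4 h5 h6 h7 h8 h9
  rw [hprodQ] at key
  -- `∏ Vⱼ / log p = ∏_{q ∈ S} log (max 4 q)`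
  set PL : ℝ := ∏ x ∈ S, Real.log ((max 4 x : ℕ) : ℝ) with hPL
  have hPV : ∏ j, V j / Real.log p = PL := by
    rw [hPL, ← hreidx (fun x => Real.log ((max 4 x : ℕ) : ℝ))]
    refine Finset.prod_congr rfl fun j _ => ?_
    simp only [hV]
    rw [← hL]
    field_simp
  have hPL0 : 0 < PL := Finset.prod_pos fun x _ => by
    linarith [(loglog_max_four_bounds x).1]
  have hW0 : 0 < W := by rw [hW]; exact mul_pos hB0 hL0
  have hlX0 : 0 < Real.log X := by linarith
  -- the garbage `(log Vmax + log p)/log p ≤ 2 + log X`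
  have hgarb : (Real.log Vmax + Real.log p) / Real.log p ≤ 2 + Real.log X := by
    rw [← hL, hVmax, Real.log_mul hL0.ne' hX0.ne']
    have hlogL : Real.log L ≤ L - 1 := Real.log_le_sub_one_of_pos hL0
    rw [div_le_iff₀ hL0]
    have hlX1 : Real.log X ≤ Real.log X * L := le_mul_of_one_le_right hlX0.le hL1.le
    nlinarith
  -- assemble: `v ≤ C p PL (log B) (2 + log X) < 5 C p² PL log B log X ≤ (5c₁m)^m p² log B log X PL`
  set v : ℝ := (padicValRat p (∏ x ∈ S, (x : ℚ) ^ e x - 1) : ℝ) with hv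
  have hCm := hC m
  have hstep1 : v ≤ C m * p * PL * Real.log B * (2 + Real.log X) := by
    have h0 : 0 ≤ C m * p * PL * Real.log B :=
      mul_nonneg (mul_nonneg (mul_nonneg hCm.1 hpR0.le) hPL0.le) hB0.le
    calc v ≤ C m * p * (∏ j, V j / Real.log p) * W * (Real.log Vmax + Real.log p) /
          Real.log p ^ 2 := key
      _ = C m * p * PL * Real.log B * ((Real.log Vmax + Real.log p) / Real.log p) := by
          rw [hPV, hW, ← hL]
          field_simp
      _ ≤ C m * p * PL * Real.log B * (2 + Real.log X) := mul_le_mul_of_nonneg_left hgarb h0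
  have henv : C m ≤ c₁ ^ m * (m : ℝ) ^ m := hCm.2
  have hspare : (p : ℝ) * (2 + Real.log X) < 5 * (p : ℝ) ^ 2 * Real.log X := by
    -- `2 + log X < 5 p log X` since `p ≥ 3`, `log X ≥ 0.27`
    have h1 : 2 + Real.log X < 5 * (p : ℝ) * Real.log X := by nlinarith
    have := mul_lt_mul_of_pos_left h1 hpR0
    linarith [this]
  have henv5 : 5 * (c₁ ^ m * (m : ℝ) ^ m) ≤ (5 * c₁ * m) ^ m := by
    rw [mul_pow, mul_pow]
    have h5 : (5 : ℝ) ≤ 5 ^ m := by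
      calc (5 : ℝ) = 5 ^ 1 := (pow_one _).symm
        _ ≤ 5 ^ m := pow_le_pow_right₀ (by norm_num) hm1
    have hc0 : 0 ≤ c₁ ^ m * (m : ℝ) ^ m := by positivity
    calc 5 * (c₁ ^ m * (m : ℝ) ^ m) ≤ 5 ^ m * (c₁ ^ m * (m : ℝ) ^ m) :=
          mul_le_mul_of_nonneg_right h5 hc0
      _ = 5 ^ m * c₁ ^ m * (m : ℝ) ^ m := by ring
  have hcm_pos : 0 < c₁ ^ m * (m : ℝ) ^ m := by
    have : (0 : ℝ) < m := by exact_mod_cast hm1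
    positivity
  have hA0 : 0 < PL * Real.log B := mul_pos hPL0 hB0
  calc v ≤ C m * p * PL * Real.log B * (2 + Real.log X) := hstep1
    _ ≤ (c₁ ^ m * (m : ℝ) ^ m) * p * PL * Real.log B * (2 + Real.log X) := by
        have h0 : 0 ≤ (p : ℝ) * PL * Real.log B * (2 + Real.log X) :=
          mul_nonneg (mul_nonneg (mul_nonneg hpR0.le hPL0.le) hB0.le) (by linarith)
        calc C m * p * PL * Real.log B * (2 + Real.log X)
            = C m * (p * PL * Real.log B * (2 + Real.log X)) := by ring
          _ ≤ (c₁ ^ m * (m : ℝ) ^ m) * (p * PL * Real.log B * (2 + Real.log X)) :=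
              mul_le_mul_of_nonneg_right henv h0
          _ = _ := by ring
    _ = (c₁ ^ m * (m : ℝ) ^ m) * (PL * Real.log B) * ((p : ℝ) * (2 + Real.log X)) := by ring
    _ < (c₁ ^ m * (m : ℝ) ^ m) * (PL * Real.log B) * (5 * (p : ℝ) ^ 2 * Real.log X) :=
        mul_lt_mul_of_pos_left hspare (mul_pos hcm_pos hA0)
    _ = (5 * (c₁ ^ m * (m : ℝ) ^ m)) * ((p : ℝ) ^ 2 * Real.log B * Real.log X * PL) := by ring
    _ ≤ (5 * c₁ * m) ^ m * ((p : ℝ) ^ 2 * Real.log B * Real.log X * PL) :=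
        mul_le_mul_of_nonneg_right henv5 (by positivity)
    _ = (5 * c₁ * m) ^ m * (p : ℝ) ^ 2 * Real.log B * Real.log X * PL := by ring

/-- **`YuNinetyOneModFour` from the floored ODD engine** (`P p := p ≠ 2`): crux stmt-ABC-19250 BY NAME.
[folklore] -/
theorem padicPrimesYuNinety_oneModFour_of_flooredOddEngine
    (hE : ∃ (C : ℕ → ℝ) (c₁ : ℝ), 1 ≤ c₁ ∧ (∀ m, 0 ≤ C m ∧ C m ≤ c₁ ^ m * (m : ℝ) ^ m) ∧
      ∀ (p : ℕ), p.Prime → p ≠ 2 → ∀ (m : ℕ) (α : Fin m → ℚ) (b : Fin m → ℤ) (V : Fin m → ℝ)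
        (Vmax W : ℝ),
        (∀ j, α j ≠ 0 ∧ padicValRat p (α j) = 0) →
        (∀ μ : Fin m → ℤ, ∏ j, α j ^ μ j = 1 → μ = 0) →
        (∀ T : Finset (Fin m), T.Nonempty → ¬ IsSquare (∏ j ∈ T, α j) ∧ ¬ IsSquare (-∏ j ∈ T, α j)) →
        (∀ j, Height.logHeight₁ (α j) ≤ V j) → (∀ j, Real.log p ≤ V j) → (∀ j, V j ≤ Vmax) →
        b ≠ 0 → (∀ j, Real.log (max 3 (|b j| : ℝ)) ≤ W) → Real.log p ≤ W →
        (padicValRat p (∏ j, α j ^ b j - 1) : ℝ) ≤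
          C m * p * (∏ j, V j / Real.log p) * W * (Real.log Vmax + Real.log p) / Real.log p ^ 2) :
    Summit.ABC.ABC.Theses.PadicPrimesYuNinety.YuNinetyOneModFour := by
  obtain ⟨C, c₁, hc₁, hC, hA⟩ := hE
  obtain ⟨c₅, h⟩ := padicPrimesYuNinety_residueClass_of_flooredEngine (fun p => p % 4 = 1) (by norm_num)
    ⟨C, c₁, hc₁, hC, fun p hp hp4 => hA p hp (by omega)⟩
  exact ⟨c₅, h⟩

/-- **`YuNinetyThreeModFour` from the floored ODD engine** (`P p := p ≠ 2`): crux stmt-ABC-19249 BY NAME.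
[folklore] -/
theorem padicPrimesYuNinety_threeModFour_of_flooredOddEngine
    (hE : ∃ (C : ℕ → ℝ) (c₁ : ℝ), 1 ≤ c₁ ∧ (∀ m, 0 ≤ C m ∧ C m ≤ c₁ ^ m * (m : ℝ) ^ m) ∧
      ∀ (p : ℕ), p.Prime → p ≠ 2 → ∀ (m : ℕ) (α : Fin m → ℚ) (b : Fin m → ℤ) (V : Fin m → ℝ)
        (Vmax W : ℝ),
        (∀ j, α j ≠ 0 ∧ padicValRat p (α j) = 0) →
        (∀ μ : Fin m → ℤ, ∏ j, α j ^ μ j = 1 → μ = 0) →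
        (∀ T : Finset (Fin m), T.Nonempty → ¬ IsSquare (∏ j ∈ T, α j) ∧ ¬ IsSquare (-∏ j ∈ T, α j)) →
        (∀ j, Height.logHeight₁ (α j) ≤ V j) → (∀ j, Real.log p ≤ V j) → (∀ j, V j ≤ Vmax) →
        b ≠ 0 → (∀ j, Real.log (max 3 (|b j| : ℝ)) ≤ W) → Real.log p ≤ W →
        (padicValRat p (∏ j, α j ^ b j - 1) : ℝ) ≤
          C m * p * (∏ j, V j / Real.log p) * W * (Real.log Vmax + Real.log p) / Real.log p ^ 2) :
    Summit.ABC.ABC.Theses.PadicPrimesYuNinety.YuNinetyThreeModFour := by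
  obtain ⟨C, c₁, hc₁, hC, hA⟩ := hE
  obtain ⟨c₅, h⟩ := padicPrimesYuNinety_residueClass_of_flooredEngine (fun p => p % 4 = 3) (by norm_num)
    ⟨C, c₁, hc₁, hC, fun p hp hp4 => hA p hp (by omega)⟩
  exact ⟨c₅, h⟩

/-- **`YuNinetyThreeModFour` from a floored engine stated at `p ≡ 3 (mod 4)` only** — the shape of
the re-registered `stub_engine` of crux 19249 (up to the order of binders). [folklore] -/
theorem padicPrimesYuNinety_threeModFour_of_flooredEngineThree
    (hE : ∃ (C : ℕ → ℝ) (c₁ : ℝ), 1 ≤ c₁ ∧ (∀ m, 0 ≤ C m ∧ C m ≤ c₁ ^ m * (m : ℝ) ^ m) ∧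
      ∀ (p : ℕ), p.Prime → p % 4 = 3 → ∀ (m : ℕ) (α : Fin m → ℚ) (b : Fin m → ℤ) (V : Fin m → ℝ)
        (Vmax W : ℝ),
        (∀ j, α j ≠ 0 ∧ padicValRat p (α j) = 0) →
        (∀ μ : Fin m → ℤ, ∏ j, α j ^ μ j = 1 → μ = 0) →
        (∀ T : Finset (Fin m), T.Nonempty → ¬ IsSquare (∏ j ∈ T, α j) ∧ ¬ IsSquare (-∏ j ∈ T, α j)) →
        (∀ j, Height.logHeight₁ (α j) ≤ V j) → (∀ j, Real.log p ≤ V j) → (∀ j, V j ≤ Vmax) →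
        b ≠ 0 → (∀ j, Real.log (max 3 (|b j| : ℝ)) ≤ W) → Real.log p ≤ W →
        (padicValRat p (∏ j, α j ^ b j - 1) : ℝ) ≤
          C m * p * (∏ j, V j / Real.log p) * W * (Real.log Vmax + Real.log p) / Real.log p ^ 2) :
    Summit.ABC.ABC.Theses.PadicPrimesYuNinety.YuNinetyThreeModFour := by
  obtain ⟨c₅, h⟩ := padicPrimesYuNinety_residueClass_of_flooredEngine (fun p => p % 4 = 3)
    (by norm_num) hE
  exact ⟨c₅, h⟩

/-- **`YuNinetyOneModFour` from a floored engine stated at `p ≡ 1 (mod 4)` only.** [folklore] -/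
theorem padicPrimesYuNinety_oneModFour_of_flooredEngineOne
    (hE : ∃ (C : ℕ → ℝ) (c₁ : ℝ), 1 ≤ c₁ ∧ (∀ m, 0 ≤ C m ∧ C m ≤ c₁ ^ m * (m : ℝ) ^ m) ∧
      ∀ (p : ℕ), p.Prime → p % 4 = 1 → ∀ (m : ℕ) (α : Fin m → ℚ) (b : Fin m → ℤ) (V : Fin m → ℝ)
        (Vmax W : ℝ),
        (∀ j, α j ≠ 0 ∧ padicValRat p (α j) = 0) →
        (∀ μ : Fin m → ℤ, ∏ j, α j ^ μ j = 1 → μ = 0) →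
        (∀ T : Finset (Fin m), T.Nonempty → ¬ IsSquare (∏ j ∈ T, α j) ∧ ¬ IsSquare (-∏ j ∈ T, α j)) →
        (∀ j, Height.logHeight₁ (α j) ≤ V j) → (∀ j, Real.log p ≤ V j) → (∀ j, V j ≤ Vmax) →
        b ≠ 0 → (∀ j, Real.log (max 3 (|b j| : ℝ)) ≤ W) → Real.log p ≤ W →
        (padicValRat p (∏ j, α j ^ b j - 1) : ℝ) ≤
          C m * p * (∏ j, V j / Real.log p) * W * (Real.log Vmax + Real.log p) / Real.log p ^ 2) :
    Summit.ABC.ABC.Theses.PadicPrimesYuNinety.YuNinetyOneModFour := by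
  obtain ⟨c₅, h⟩ := padicPrimesYuNinety_residueClass_of_flooredEngine (fun p => p % 4 = 1) (by norm_num) hE
  exact ⟨c₅, h⟩

end Summit.ABC.ABC.Theorems

end
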